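import Summits.MatrixMultiplication.MatrixMultiplication.Theorems.ObstructionDescentSaturationSplit
import Literature.Computability.AlgebraicComplexity.UnitTensorMomentPolytopeHolds
import Literature.Computability.AlgebraicComplexity.UnitTensorSLObstructionsOccurrence

set_option linter.dupNamespace false
set_option autoImplicit false

/-!
# Obstruction descent — the cell `n = 2` of the SAT/TOR split, named facts DISCHARGED (decomp-mm · lens 3 · gen 30, def-free)

`route-MatrixMultiplication-ObstructionDescent`, crux `NoOccurrenceObstruction` (`P_O`, stmt 29040); companion of
`Theorems/ObstructionDescentSaturationSplit.lean`, whose `n = 2` theorems take the `4×4×4` unit-tensor polytope maximality and the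
Bürgisser–Ikenmeyer Lemma 6.1 witness as hypotheses.  Both are THEOREMS of the tree
(`vandenBergEtAl2025_unitTensor_four_polytope_maximal_holds`, `burgisserIkenmeyer2011_lemma_6_1_holds`), so at `n = 2`,
unconditionally:  SAT(⟨2,2,2⟩, ⟨m⟩) for every `m ≥ 4` (`sat_two`);  ¬TOR(⟨2,2,2⟩, ⟨m⟩) and ¬(S(⟨2,2,2⟩) ⊆ S(⟨m⟩)) for
`m ∈ {4, 5}` (`not_tor_two`, `not_semigroup_le_two`), witnessed by `λ₂ = ((5,1,1,1),(2,2,2,2),(2,2,2,2)) ⊢ 8`;  everything from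
`m ≥ 7` (`semigroup_le_two_of_seven_le`); and for EVERY `n ≥ 2` the cells `m ≤ n² + 1` of `P_O` fail
(`not_semigroup_le_of_le_sq_add_one`), TOR failing there as soon as SAT holds (`not_tor_of_sat_of_le_sq_add_one`).  At `n = 2` the obstruction to `P_O` is pure torsion; the cell `m = 6` is open.
No proposition is defined; no `def`; sorry-free; standard axioms.  Nothing here proves `ω = 2` or closes an item.
[cite: BurgisserIkenmeyer2011, Lemma 6.1] [cite: vandenBergChristandlLysikovNieuwboerWalterZuiddam2025, §1]
-/

noncomputable section

namespace Summit.MatrixMultiplication.MatrixMultiplication.Theorems.ObstructionCalculus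

open Literature.Computability.AlgebraicComplexity (kroneckerPow isotypicSum₁ isotypicSum₂ isotypicSum₃ matMulTensor unitTensor
  bi2011Last bi2011TwoRect vandenBergEtAl2025_unitTensor_four_polytope_maximal_holds burgisserIkenmeyer2011_lemma_6_1_holds)

/-- **SAT(⟨2,2,2⟩, ⟨m⟩) for every `m ≥ 4`, unconditionally.** [cite: vandenBergChristandlLysikovNieuwboerWalterZuiddam2025, §1] -/
theorem sat_two {m : ℕ} (hm : 4 ≤ m) (d : ℕ) (lam : Fin 3 → Nat.Partition d) (hd : 0 < d)
    (hs : isotypicSum₁ (lam 0) (isotypicSum₂ (lam 1) (isotypicSum₃ (lam 2)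
      (kroneckerPow (matMulTensor ℂ 2 2 2) d))) ≠ 0) :
    ∃ (k : ℕ) (mu : Fin 3 → Nat.Partition (k * d)), 0 < k ∧
      (∀ j, (mu j).parts = (lam j).parts.map (fun p => k * p)) ∧
      isotypicSum₁ (mu 0) (isotypicSum₂ (mu 1) (isotypicSum₃ (mu 2) (kroneckerPow (unitTensor ℂ m) (k * d)))) ≠ 0 :=
  sat_two_of_four_polytope_maximal vandenBergEtAl2025_unitTensor_four_polytope_maximal_holds hm d lam hd hs

/-- **¬TOR(⟨2,2,2⟩, ⟨m⟩) for `m ∈ {4,5}`, unconditionally** (witness `λ₂` of BI 2011 Lemma 6.1).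
[cite: BurgisserIkenmeyer2011, Lemma 6.1] -/
theorem not_tor_two {m : ℕ} (hm4 : 4 ≤ m) (hm5 : m ≤ 5) :
    ¬ (∀ (d : ℕ) (lam : Fin 3 → Nat.Partition d) (k : ℕ) (mu : Fin 3 → Nat.Partition (k * d)), 0 < k →
        (∀ j, (mu j).parts = (lam j).parts.map (fun p => k * p)) →
        isotypicSum₁ (lam 0) (isotypicSum₂ (lam 1) (isotypicSum₃ (lam 2)
          (kroneckerPow (matMulTensor ℂ 2 2 2) d))) ≠ 0 →
        isotypicSum₁ (mu 0) (isotypicSum₂ (mu 1) (isotypicSum₃ (mu 2) (kroneckerPow (unitTensor ℂ m) (k * d)))) ≠ 0 →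
        isotypicSum₁ (lam 0) (isotypicSum₂ (lam 1) (isotypicSum₃ (lam 2) (kroneckerPow (unitTensor ℂ m) d))) ≠ 0) := by
  have h61 := burgisserIkenmeyer2011_lemma_6_1_holds 2 le_rfl
  exact not_tor_two_of_witness vandenBergEtAl2025_unitTensor_four_polytope_maximal_holds (d := 2 * 2 ^ 2) (by norm_num)
    ![bi2011Last 2 le_rfl, bi2011TwoRect 2, bi2011TwoRect 2] h61.1 h61.2 hm4 hm5

/-- **¬(S(⟨2,2,2⟩) ⊆ S(⟨m⟩)) for `m ≤ 5`, unconditionally** (`P_O`'s cell `(2, m)` fails there).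
[cite: BurgisserIkenmeyer2011, Lemma 6.1] -/
theorem not_semigroup_le_two {m : ℕ} (hm5 : m ≤ 5) :
    ¬ (∀ (d : ℕ) (lam : Fin 3 → Nat.Partition d),
        isotypicSum₁ (lam 0) (isotypicSum₂ (lam 1) (isotypicSum₃ (lam 2)
          (kroneckerPow (matMulTensor ℂ 2 2 2) d))) ≠ 0 →
        isotypicSum₁ (lam 0) (isotypicSum₂ (lam 1) (isotypicSum₃ (lam 2) (kroneckerPow (unitTensor ℂ m) d))) ≠ 0) := by
  have h61 := burgisserIkenmeyer2011_lemma_6_1_holds 2 le_rfl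
  exact not_semigroup_le_two_of_witness ![bi2011Last 2 le_rfl, bi2011TwoRect 2, bi2011TwoRect 2] h61.1 h61.2 hm5

/-- **The cell `(2, m)` of `P_O` forces `m ≥ 6`**: if `S(⟨2,2,2⟩) ⊆ S(⟨m⟩)` then `6 ≤ m` (contrapositive of
`not_semigroup_le_two`). [cite: BurgisserIkenmeyer2011, Lemma 6.1] -/
theorem six_le_of_semigroup_le_two {m : ℕ}
    (h : ∀ (d : ℕ) (lam : Fin 3 → Nat.Partition d),
        isotypicSum₁ (lam 0) (isotypicSum₂ (lam 1) (isotypicSum₃ (lam 2)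
          (kroneckerPow (matMulTensor ℂ 2 2 2) d))) ≠ 0 →
        isotypicSum₁ (lam 0) (isotypicSum₂ (lam 1) (isotypicSum₃ (lam 2) (kroneckerPow (unitTensor ℂ m) d))) ≠ 0) :
    6 ≤ m := by
  by_contra hm
  exact not_semigroup_le_two (by omega) h

/-- **The diagonal `m ≤ n² + 1` of `P_O`'s cell table fails for EVERY `n ≥ 2`, unconditionally**: `S(⟨n,n,n⟩) ⊄ S(⟨m⟩)` for
`m ≤ n² + 1`, witnessed by Bürgisser–Ikenmeyer's `λₙ = ((2n²−3,1,1,1),(2^{n²}),(2^{n²})) ⊢ 2n²` (tree theorem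
`burgisserIkenmeyer2011_lemma_6_1_holds`) and format monotonicity.  So the `∃ n₀` of `P_O` is forced to wait for `⌈n^τ⌉ ≥ n² + 2`.
[cite: BurgisserIkenmeyer2011, Lemma 6.1] -/
theorem not_semigroup_le_of_le_sq_add_one (n : ℕ) (hn : 2 ≤ n) {m : ℕ} (hm : m ≤ n ^ 2 + 1) :
    ¬ (∀ (d : ℕ) (lam : Fin 3 → Nat.Partition d),
        isotypicSum₁ (lam 0) (isotypicSum₂ (lam 1) (isotypicSum₃ (lam 2)
          (kroneckerPow (matMulTensor ℂ n n n) d))) ≠ 0 →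
        isotypicSum₁ (lam 0) (isotypicSum₂ (lam 1) (isotypicSum₃ (lam 2) (kroneckerPow (unitTensor ℂ m) d))) ≠ 0) := by
  intro h
  have h61 := burgisserIkenmeyer2011_lemma_6_1_holds n hn
  exact (isotypicSum_kroneckerPow_unitTensor_mono hm ![bi2011Last n hn, bi2011TwoRect n, bi2011TwoRect n]
    (h (2 * n ^ 2) ![bi2011Last n hn, bi2011TwoRect n, bi2011TwoRect n] h61.1)) h61.2

/-- **TOR fails wherever SAT holds on that diagonal** (general `n ≥ 2`, `m ≤ n² + 1`): relative saturation of `S(⟨m⟩)` with respect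
to `S(⟨n,n,n⟩)` is refuted by `λₙ` as soon as SAT(⟨n,n,n⟩, ⟨m⟩) holds — e.g. under unit-tensor polytope maximality at format `m`
(Bürgisser–Ikenmeyer 2011 Problem 8.3).  At `n = 2` SAT is a theorem (`sat_two`), giving `not_tor_two`.
[cite: BurgisserIkenmeyer2011, Lemma 6.1 and Problem 8.3] -/
theorem not_tor_of_sat_of_le_sq_add_one (n : ℕ) (hn : 2 ≤ n) {m : ℕ} (hm : m ≤ n ^ 2 + 1)
    (hsat : ∀ (d : ℕ) (lam : Fin 3 → Nat.Partition d), 0 < d →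
        isotypicSum₁ (lam 0) (isotypicSum₂ (lam 1) (isotypicSum₃ (lam 2)
          (kroneckerPow (matMulTensor ℂ n n n) d))) ≠ 0 →
        ∃ (k : ℕ) (mu : Fin 3 → Nat.Partition (k * d)), 0 < k ∧
          (∀ j, (mu j).parts = (lam j).parts.map (fun p => k * p)) ∧
          isotypicSum₁ (mu 0) (isotypicSum₂ (mu 1) (isotypicSum₃ (mu 2) (kroneckerPow (unitTensor ℂ m) (k * d)))) ≠ 0) :
    ¬ (∀ (d : ℕ) (lam : Fin 3 → Nat.Partition d) (k : ℕ) (mu : Fin 3 → Nat.Partition (k * d)), 0 < k →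
        (∀ j, (mu j).parts = (lam j).parts.map (fun p => k * p)) →
        isotypicSum₁ (lam 0) (isotypicSum₂ (lam 1) (isotypicSum₃ (lam 2)
          (kroneckerPow (matMulTensor ℂ n n n) d))) ≠ 0 →
        isotypicSum₁ (mu 0) (isotypicSum₂ (mu 1) (isotypicSum₃ (mu 2) (kroneckerPow (unitTensor ℂ m) (k * d)))) ≠ 0 →
        isotypicSum₁ (lam 0) (isotypicSum₂ (lam 1) (isotypicSum₃ (lam 2) (kroneckerPow (unitTensor ℂ m) d))) ≠ 0) := by
  intro htor
  exact not_semigroup_le_of_le_sq_add_one n hn hm ((semigroup_le_iff_sat_and_tor _ _).2 ⟨hsat, htor⟩)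

end Summit.MatrixMultiplication.MatrixMultiplication.Theorems.ObstructionCalculus

end
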